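import Summits.HodgeConjecture.HodgeConjecture.Theses.NikulinTwinTransport
import Literature.AlgebraicGeometry.Surfaces.K3Marking
import HarnessLib

/-!
# Route NikulinTwinTransport · X = `TwinSimilitudeAlgebraic` (stmt-HodgeConjecture-13674) —
# the OUT-ANCHOR GLUE and the K3-intrinsic half of line `hyperkaehler-nikulin-anchors`

Glue to the target in the sense of the route's support item `TwinAnchorGlue` (stmt-HodgeConjecture-14394:
"Buskin + anchors ⟹ X"), in the TRANSPOSE-FREE form found by the line lead of crux 13674 (reshape r1 of
`Cruxes/TwinSimilitudeAlgebraic/Lines/hyperkaehler_nikulin_anchors.lean`): X at a pair `(S, S′)` follows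
from an algebraic OUT-anchor at the SOURCE `S′` — a `ℂ`-linear equivalence `Ψ : H²(S′) ⥲ H²(Σ)` into some
projective K3 `Σ`, algebraic as a correspondence `S′ ⊢ Σ`, whose inverse is rational, type-preserving and
halves the cup form — because `ψ ∘ Ψ⁻¹ : H²(Σ) → H²(S)` is then a rational Hodge ISOMETRY, algebraic by
Buskin (`HodgeIsometryAlgebraic`, item 13675), and `ψ = (ψ ∘ Ψ⁻¹) ∘ Ψ` is a composition of algebraic
correspondences `S′ ⊢ Σ ⊢ S` (`CompCorr`, Fulton Prop. 16.1.1 / Buskin Lemma 6.3 — the hypothesis the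
item `TwinAnchorGlue` itself hinges on).  This file:

* `simAlg_at_of_outAnchor` — X at `(S, S′)` from an out-anchor at `S′`, Buskin and `CompCorr`.

The companion file `NikulinTwinTransportTwinSimilitudeAlgebraicPartialTwinGlue` completes a PARTIAL
algebraic twin class (the output of the line's hyperkähler heart) to an out-anchor with the three landed
stubs of the line, whence X for every pair whose source admits one.  No definitions, no named facts
beyond the hypotheses; axioms standard.  Prover seat prover-line-stmt-HodgeConjecture-13674-0 (line lead).

## References

* [Varesco2023] M. Varesco, Hodge similarities, algebraic classes, and Kuga–Satake varieties, Math. Z. 305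
  (2023), §2 (similarity = algebraic similarity ∘ isometry).
* [Buskin2019] N. Buskin, Every rational Hodge isometry between two K3 surfaces is algebraic, J. reine
  angew. Math. 755 (2019), Thm. 1.1 and Lemma 6.3.
* [Huybrechts2019] D. Huybrechts, Motives of isogenous K3 surfaces, Comment. Math. Helv. 94 (2019), §1.
* [Fulton1998] W. Fulton, Intersection Theory, 2nd ed., §16.1 Prop. 16.1.1.
-/

noncomputable section

set_option linter.dupNamespace false

open CategoryTheory MonoidalCategory
open scoped Manifold Matrix
open Literature.AlgebraicGeometry.Motives Literature.AlgebraicGeometry.HodgeTheory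
open Literature.AlgebraicGeometry.Surfaces Literature.Geometry.Kaehler
open Literature.AlgebraicTopology.SingularHomology
open Summit.HodgeConjecture.HodgeConjecture.Theses.NikulinTwinTransport

namespace Summit.HodgeConjecture.HodgeConjecture.Theorems.NikulinTwinTransport

/-! ## Local notations (verbatim those of the line's skeleton and of the route's Theorems files) -/

/-- `Gen[S, p]`: `p` is an integral generator of `H⁴(S(ℂ); ℂ)` (the generator clause of X). Local notation
only. -/
local notation3 (prettyPrint := false) "Gen[" S ", " p "]" =>
  (IsIntegralClass p ∧ ∀ q : complexBetti S (2 * 2), IsIntegralClass q → ∃ n : ℤ, q = n • p)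

/-- `Corr[μ, S, S', hS, hS' ; γ, y] = [γ]_* y = fst_*(snd^* y ∪ γ)`, the action of
`γ ∈ H⁴((S ⊗ S′)(ℂ); ℂ)` as a correspondence `H²(S′) → H²(S)` (the FIRST factor receives). Local notation
only, verbatim from the route's Theorems files; for `hS hS'` the K3 witnesses it is definitionally the
inline term of the route items. -/
local notation3 (prettyPrint := false) "Corr[" μ ", " S ", " S' ", " hS ", " hS' " ; " γ ", " y "]" =>
  complexGysin μ
    (IsSmoothProjective.tensor_holds (IsK3Surface.isSmoothProjective hS)
      (IsK3Surface.isSmoothProjective hS'))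
    (IsK3Surface.isSmoothProjective hS) (SemiCartesianMonoidalCategory.fst S S')
    (rfl : 2 * 1 + 2 * 2 + 2 * 2 = 2 * 1 + 2 * (2 + 2))
    (cupProduct (rfl : 2 * 1 + 2 * 2 = 2 * 1 + 2 * 2)
      (complexBetti.map (SemiCartesianMonoidalCategory.snd S S') (2 * 1) y) γ)

/-- `CompCorr`: composition of algebraic degree-`2` correspondences between smooth projective surfaces
acts as an algebraic correspondence — hypothesis (C) of `twinSimilitudeAlgebraic_of_anchor`, verbatim
(the tree proves it from the multiplicativity `N² ∪ N² ⊆ N⁴`: `corrComp_surfaces_of_cup'`; route item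
`TwinAnchorGlue` is its packaged use). Local notation only. -/
local notation3 (prettyPrint := false) "CompCorr" =>
  ∀ (μ : OrientationFamily), μ.HasPoincareDuality →
    ∀ (A B C : SchemeOver ℂ) (hA : IsSmoothProjective 2 A) (hB : IsSmoothProjective 2 B)
      (hC : IsSmoothProjective 2 C),
      ∀ γ ∈ algebraicClasses (MonoidalCategoryStruct.tensorObj A B) 2,
        ∀ γ₁ ∈ algebraicClasses (MonoidalCategoryStruct.tensorObj B C) 2,
          ∃ γ₂ ∈ algebraicClasses (MonoidalCategoryStruct.tensorObj A C) 2,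
            ∀ x : complexBetti C (2 * 1),
              complexGysin μ (IsSmoothProjective.tensor_holds hA hC) hA
                  (SemiCartesianMonoidalCategory.fst A C)
                  (rfl : 2 * 1 + 2 * 2 + 2 * 2 = 2 * 1 + 2 * (2 + 2))
                  (cupProduct (rfl : 2 * 1 + 2 * 2 = 2 * 1 + 2 * 2)
                    (complexBetti.map (SemiCartesianMonoidalCategory.snd A C) (2 * 1) x) γ₂) =
                complexGysin μ (IsSmoothProjective.tensor_holds hA hB) hA
                  (SemiCartesianMonoidalCategory.fst A B)
                  (rfl : 2 * 1 + 2 * 2 + 2 * 2 = 2 * 1 + 2 * (2 + 2))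
                  (cupProduct (rfl : 2 * 1 + 2 * 2 = 2 * 1 + 2 * 2)
                    (complexBetti.map (SemiCartesianMonoidalCategory.snd A B) (2 * 1)
                      (complexGysin μ (IsSmoothProjective.tensor_holds hB hC) hB
                        (SemiCartesianMonoidalCategory.fst B C)
                        (rfl : 2 * 1 + 2 * 2 + 2 * 2 = 2 * 1 + 2 * (2 + 2))
                        (cupProduct (rfl : 2 * 1 + 2 * 2 = 2 * 1 + 2 * 2)
                          (complexBetti.map (SemiCartesianMonoidalCategory.snd B C) (2 * 1) x)
                          γ₁)))
                    γ)

/-- `OutAnchor[μ, S, Sg, hS, hSg, p, pg]`: AN ALGEBRAIC OUT-ANCHOR `2`-SIMILITUDE AT `S` WITH PARTNER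
`Sg` — a `ℂ`-linear equivalence `Ψ : H²(S) ≃ H²(Sg)` which is algebraic (the action of an algebraic
class on `Sg ⊗ S`) and whose inverse is rational, type-preserving and HALVES the cup form
(`(u.v) = 2b·pg ⟹ (Ψ⁻¹u.Ψ⁻¹v) = b·p`).  Symbol for symbol the body of `AnchorData[μ, Sg, hSg, pg]`
(= the body of the route crux `TwinTwistorTransport` at `Sg`) with the partner `S″ := S`, `p″ := p`.
Local notation only. -/
local notation3 (prettyPrint := false)
    "OutAnchor[" μ ", " S ", " Sg ", " hS ", " hSg ", " p ", " pg "]" =>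
  ∃ Ψ : complexBetti S (2 * 1) ≃ₗ[ℂ] complexBetti Sg (2 * 1),
    (∀ y, IsRationalClass y → IsRationalClass (Ψ.symm y)) ∧
    (∀ (i j : ℕ) y, IsOfHodgeType 2 Sg (2 * 1) i j y →
      IsOfHodgeType 2 S (2 * 1) i j (Ψ.symm y)) ∧
    (∀ (u v : complexBetti Sg (2 * 1)) (b : ℂ),
      cupProduct (rfl : 2 * 1 + 2 * 1 = 2 * 2) u v = ((2 : ℂ) * b) • pg →
        cupProduct (rfl : 2 * 1 + 2 * 1 = 2 * 2) (Ψ.symm u) (Ψ.symm v) = b • p) ∧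
    ∃ γ ∈ algebraicClasses (MonoidalCategoryStruct.tensorObj Sg S) 2,
      ∀ x : complexBetti S (2 * 1), Ψ x = Corr[μ, Sg, S, hSg, hS ; γ, x]



/-! ## X at one pair from one out-anchor at the source -/

/-- **X at one pair from one OUT-anchor at the SOURCE** (the transpose-free form of the landed
`similitudeAlgebraic_of_anchor`, `r = 2`): Buskin's theorem (`HodgeIsometryAlgebraic`, item 13675), the
composition of degree-`2` correspondences between smooth projective surfaces, and an algebraic out-anchor
`Ψ : H²(S′) ⥲ H²(Σ)` at the source make every rational, type-preserving `2`-similitude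
`ψ : H²(S′) → H²(S)` into any projective K3 `S` algebraic: `ψ ∘ Ψ⁻¹ : H²(Σ) → H²(S)` is a rational Hodge
ISOMETRY (`(u.v) = a·pΣ = 2(a/2)·pΣ ⟹ (Ψ⁻¹u.Ψ⁻¹v) = (a/2)·p′ ⟹ (ψΨ⁻¹u.ψΨ⁻¹v) = a·p`), algebraic by
Buskin; compose with `Ψ = [γ]_*` (`S′ ⊢ Σ ⊢ S`). [cite: Varesco2023, §2]
[cite: Buskin2019, Thm. 1.1 and Lemma 6.3] -/
theorem simAlg_at_of_outAnchor (hB : HodgeIsometryAlgebraic) (hC : CompCorr)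
    {μ : OrientationFamily} (hμ : μ.HasPoincareDuality)
    {S' : SchemeOver ℂ} (hS' : IsK3Surface S') {p' : complexBetti S' (2 * 2)}
    {Sg : SchemeOver ℂ} (hSg : IsK3Surface Sg) {pg : complexBetti Sg (2 * 2)} (hpg : Gen[Sg, pg])
    (hA : OutAnchor[μ, S', Sg, hS', hSg, p', pg])
    (S : SchemeOver ℂ) (hS : IsK3Surface S) (p : complexBetti S (2 * 2)) (hp : Gen[S, p])
    (ψ : complexBetti S' (2 * 1) →ₗ[ℂ] complexBetti S (2 * 1))
    (hψr : ∀ x, IsRationalClass x → IsRationalClass (ψ x))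
    (hψt : ∀ (i j : ℕ) x, IsOfHodgeType 2 S' (2 * 1) i j x → IsOfHodgeType 2 S (2 * 1) i j (ψ x))
    (hψs : ∀ (x y : complexBetti S' (2 * 1)) (a : ℂ),
      cupProduct (rfl : 2 * 1 + 2 * 1 = 2 * 2) x y = a • p' →
        cupProduct (rfl : 2 * 1 + 2 * 1 = 2 * 2) (ψ x) (ψ y) = ((2 : ℂ) * a) • p) :
    ∃ γ ∈ algebraicClasses (MonoidalCategoryStruct.tensorObj S S') 2,
      ∀ x : complexBetti S' (2 * 1), ψ x = Corr[μ, S, S', hS, hS' ; γ, x] := by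
  obtain ⟨Ψ, hΨr, hΨt, hΨs, γ, hγ, hΨγ⟩ := hA
  -- `φ := ψ ∘ Ψ⁻¹ : H²(Σ) → H²(S)` is a rational Hodge isometry.
  have hφr : ∀ u, IsRationalClass u → IsRationalClass ((ψ ∘ₗ Ψ.symm.toLinearMap) u) :=
    fun u hu => hψr _ (hΨr u hu)
  have hφt : ∀ (i j : ℕ) u, IsOfHodgeType 2 Sg (2 * 1) i j u →
      IsOfHodgeType 2 S (2 * 1) i j ((ψ ∘ₗ Ψ.symm.toLinearMap) u) :=
    fun i j u hu => hψt i j _ (hΨt i j u hu)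
  have hφs : ∀ (u v : complexBetti Sg (2 * 1)) (a : ℂ),
      cupProduct (rfl : 2 * 1 + 2 * 1 = 2 * 2) u v = a • pg →
        cupProduct (rfl : 2 * 1 + 2 * 1 = 2 * 2) ((ψ ∘ₗ Ψ.symm.toLinearMap) u)
          ((ψ ∘ₗ Ψ.symm.toLinearMap) v) = a • p := by
    intro u v a huv
    have ha : (2 : ℂ) * (a / 2) = a := by ring
    have h2 : cupProduct (rfl : 2 * 1 + 2 * 1 = 2 * 2) u v = ((2 : ℂ) * (a / 2)) • pg := by
      rw [huv, ha]
    have h3 := hψs _ _ (a / 2) (hΨs u v (a / 2) h2)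
    rw [ha] at h3
    simpa only [LinearMap.coe_comp, LinearEquiv.coe_coe, Function.comp_apply] using h3
  -- Buskin for the K3 pair `(S, Σ)`, then compose `S′ ⊢ Σ ⊢ S`.
  obtain ⟨β, hβ, hφβ⟩ :=
    hB μ hμ S Sg hS hSg p pg hp hpg (ψ ∘ₗ Ψ.symm.toLinearMap) hφr hφt hφs
  obtain ⟨γ₂, hγ₂, hcomp⟩ := hC μ hμ S Sg S' (IsK3Surface.isSmoothProjective hS)
    (IsK3Surface.isSmoothProjective hSg) (IsK3Surface.isSmoothProjective hS') β hβ γ hγ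
  refine ⟨γ₂, hγ₂, fun x => ?_⟩
  rw [hcomp x, ← hΨγ x, ← hφβ (Ψ x)]
  simp

end Summit.HodgeConjecture.HodgeConjecture.Theorems.NikulinTwinTransport

end
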